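import Mathlib
import Summits.QuantumFields.QCD.Theses.PauliWegnerSea
import Literature.MathematicalPhysics.QuantumFieldTheory.QCDPhaseQuenched
import Literature.MathematicalPhysics.QuantumFieldTheory.FermiFlavourPhase

/-!
# Stub `stub_wickSum` of line `crossing-split-integrability` (r2, short registrable form)
(crux `Summit.QuantumFields.QCD.Theses.PauliWegnerSea.PhaseQuenchedFlavourDecay` =
`Summit.QuantumFields.QCD.Theses.WilsonMobilityGap.PhaseQuenchedFlavourDecay`, item stmt-QuantumFields-9151)

The generic phase-quenched SUMMATION step of the line: if a complex observable `φ` of the gauge field is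
dominated pointwise by a finite non-negative combination `Σ_i c_i g_i` of real observables, each `g_i`
integrable under the phase-quenched probability measure `qcdLatticeMeasure` with phase-quenched
expectation `⟨g_i⟩₊ ≤ C_i E`, then the phase-quenched complex quotient
`∫ (|det D| : ℂ) φ dμ_W / ∫ (|det D| : ℂ) dμ_W` has norm `≤ (Σ_i c_i C_i) E`.
In the skeleton (`Cruxes/PhaseQuenchedFlavourDecay/Lines/crossing-split-integrability.lean`, r2) the r1 form
`(∀ Nf, WickBound Nf) → ∀ Nf reg m, MinorDecay → Conc` is derived from this by the sorry-free glue
`wickSum_composed` (Wick bound from `stub_wickExpansion`, minor decay from `stub_decayTransfer`).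
Proof: `qcdPhaseQuenchedExpect_eq_div_complex`, `qcdPhaseQuenchedExpect_eq_integral_qcdLatticeMeasure`,
`norm_integral_le_of_norm_le`, linearity of the integral over the finite sum.  (Worker proof, wave 1.)
-/

noncomputable section

namespace Summit.QuantumFields.QCD.Cruxes.PhaseQuenchedFlavourDecay.CrossingSplitIntegrability

open scoped BigOperators
open MeasureTheory Filter
open Literature.MathematicalPhysics.QuantumFieldTheory Literature.MathematicalPhysics.QuantumLattice
  Literature.Probability.LatticeModels

/-- Registered stub `stub_wickSum` (r2 short form) of line `crossing-split-integrability` for crux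
stmt-QuantumFields-9151 — the generic phase-quenched summation step: if `‖φ‖ ≤ Σ_i c_i g_i` pointwise with `c_i ≥ 0`, each `g_i` is
`qcdLatticeMeasure`-integrable with `⟨g_i⟩₊ ≤ C_i E`, then the phase-quenched quotient of `φ` has norm
`≤ (Σ_i c_i C_i) E`. -/
theorem stub_wickSum :
    ∀ (Nf : ℕ) (ι : Type) [Fintype ι] (S : ℕ) [NeZero S] (β : ℝ) (mq : Fin Nf → ℝ)
      (φ : GaugeConfig 4 S SU3 → ℂ) (g : ι → GaugeConfig 4 S SU3 → ℝ) (c C : ι → ℝ) (E : ℝ),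
      (∀ i, 0 ≤ c i) →
      (∀ i, Integrable (g i) (qcdLatticeMeasure S β mq) ∧
        qcdPhaseQuenchedExpect β S mq (g i) ≤ C i * E) →
      (∀ U, ‖φ U‖ ≤ ∑ i, c i * g i U) →
      ‖(∫ U : GaugeConfig 4 S SU3, (‖(diracMatrix U mq).det‖ : ℂ) * φ U
            ∂(wilsonMeasure (fundamentalRep (Fin 3)) β)) /
          ∫ U : GaugeConfig 4 S SU3, (‖(diracMatrix U mq).det‖ : ℂ)
            ∂(wilsonMeasure (fundamentalRep (Fin 3)) β)‖ ≤
        (∑ i, c i * C i) * E := by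
  intro Nf ι _ S _ β mq φ g c C E hc hdata hbound
  rw [← qcdPhaseQuenchedExpect_eq_div_complex, qcdPhaseQuenchedExpect_eq_integral_qcdLatticeMeasure]
  calc ‖∫ U, φ U ∂(qcdLatticeMeasure S β mq)‖
      ≤ ∫ U, ∑ i, c i * g i U ∂(qcdLatticeMeasure S β mq) :=
        norm_integral_le_of_norm_le (integrable_finsetSum _ fun i _ => (hdata i).1.const_mul (c i))
          (Eventually.of_forall hbound)
    _ = ∑ i, c i * ∫ U, g i U ∂(qcdLatticeMeasure S β mq) := by
        rw [integral_finsetSum _ fun i _ => (hdata i).1.const_mul (c i)]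
        exact Finset.sum_congr rfl fun i _ => integral_const_mul _ _
    _ ≤ ∑ i, c i * (C i * E) :=
        Finset.sum_le_sum fun i _ => mul_le_mul_of_nonneg_left
          (by rw [← qcdPhaseQuenchedExpect_eq_integral_qcdLatticeMeasure]; exact (hdata i).2) (hc i)
    _ = (∑ i, c i * C i) * E := by
        rw [Finset.sum_mul]
        exact Finset.sum_congr rfl fun i _ => (mul_assoc _ _ _).symm

end Summit.QuantumFields.QCD.Cruxes.PhaseQuenchedFlavourDecay.CrossingSplitIntegrability

end
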